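import Literature.Analysis.Complex.OsgoodProofs
import Literature.MathematicalPhysics.QuantumFieldTheory.Balaban1983to89.B12Ineq45

/-!
# Bałaban, *The variational problem and background fields in renormalization group method for lattice gauge
# theories* (CMP 102, 1985), Sect. G (190) p. 308 / Prop. 9 p. 309 ⟶ *Renormalization group approach to lattice
# gauge field theories. I* (CMP 109, 1987), §4 p. 282 and p. 286: the decay of the HIGHER variational derivatives
# `⟨δⁿ𝓗(0), ⊗_i B_i⟩` of one block — KERNEL-CHECKED from the first-order bound (190) at complex base points, the
# Cauchy estimate of (185), and the symmetry of `δⁿ𝓗`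

Sources reproduced (statement level + kernel bookkeeping; the series 𝓗 itself is not constructed here):

* T. Bałaban, CMP **102** (1985) 277–309 [`Balaban1985Variational`; renders
  `b2b-balaban-ref1/pages/1985-cmp102-variational-background/…-p032-x2.png`, `…-p033-x2.png` read as images for
  this module].

  p. 308 [PDF 32], (185), verbatim — the paper's own move for a SECOND variational derivative:
  *"(δ²/δA′² V)(A′)𝔄 = (d/dτ)(δ/δA′ V)(A′ + τ𝔄)|_{τ=0} = (1/2πi) ∮_{|τ|=r} (dτ/τ²) (δ/δA′ V)(A′ + τ𝔄)  and taking
  r = max{|A′|_{(−1)}, |∇A′|_{(−2)}}(max{|𝔄|_{(−1)}, |∇𝔄|_{(−2)}})⁻¹, we get from Proposition 4 … (186)"*.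

  p. 308 [PDF 32], (190), verbatim: *"This inequality, the formula (188) and Lemma 2.1, and finally Proposition 2
  and (181), yield  |(δ/δB_ν(y′))𝓗_μ(B, x)|, |∇_x(δ/δB_ν(y′))𝓗_μ(B, x)|, ‖ζ∇(δ/δB(y′))𝓗(B)‖_β,
  |D^{η*}_{U_k}D^η_{U_k}(δ/δB_ν(y))𝓗_μ(B, x)|, |Δ^η_{U_k}(δ/δB_ν(y′))𝓗_μ(B, x)|
  ≤ O(1)[(L^jη)^{−1}, (L^jη)^{−2}, (‖ζ‖^#_β + |ζ|)(L^jη)^{−2−β}, (L^jη)^{−3}, (L^jη)^{−3}]·(L^{j′}η)^{−d}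
  exp(−⅛δ₀d(y, y′))  (190)  for x ∈ Δ(y), or supp ζ ⊂ Δ̃(y), y ∈ Λ_j, y′ ∈ Λ_{j′}."*

  p. 309 [PDF 33], Proposition 9, verbatim: *"The minimal configuration U_k(V) = U_k(V′V₀) in the axial gauge has
  an extension to an analytic function of Gᶜ-valued small configurations V′ on 𝔅_k. … The function 𝓗(B) is
  determined by Eqs. (174), (175), or (179), (180). It is an analytic function of B, and also of the external gauge
  field configuration U … It satisfies the conditions (19)–(21) with ε₂ = B₅ε₁ (see (173)), and its functional
  derivative (182) satisfies the inequalities (190)."*  (With (172): the domain is the complex ball |B| < 2C₁ε₁ =: a,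
  an absolute radius; typed in the tree as `B11.Prop9Printed`, which asserts (190) for EVERY B of that ball.)

* T. Bałaban, CMP **109** (1987) 249–301 [`Balaban1987RG1`; renders
  `b2b-balaban-ref1/pages/1987-cmp109-rg-I-small-field/…-p034-x2.png`, `…-p038-x2.png` read as images].

  p. 282 [PDF 34], verbatim: *"The functional derivative (δ^{n(p)})/(δB^{n(p)})𝐇_j(□₀, 0) is given by a sum of
  several perturbative expressions discussed in Sect. G [15]. Each expression corresponds to a tree graph with n(p)
  initial points and one final point, and it has an exponential decay in a length of this graph. The derivative has
  an exponential decay in a length of a shortest tree graph of this type. The norm in (4.4) of the expression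
  ⟨δ^{n(p)}/δB^{n(p)} 𝐇_j(□₀, 0), ⊗_{i∈N(p)} B_i⟩ can be estimated by B₃ Π_{i∈N(p)} |B_i|, and if one of the
  functions B_i is localized outside the domain X, then we have the additional exponential factor
  exp(−δ₀ dist^{(ξ)}(X, supp B_i))."*

  p. 286 [PDF 38], verbatim: *"We have to use the exponential decay properties to get a proper bound. Consider two
  possible cases. In the first the points x, x₃ are connected with the same set N(p) in (4.3). Then the exponential
  factor, with a length of a shortest tree graph in the exponent, yields the factor exp(−δ₀|x₃ − x|), and the
  product of it with |x₃ − x| is bounded by δ₀⁻¹."*  and  *"More generally, let us notice that by a similar argument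
  we can bound the derivative 𝐄^{(n)}(X, x₁, …, x_n) by a constant times the exponential
  exp(−O(1)κd_j(X∪{x₁, …, x_n})), where d_j(X∪{x₁, …, x_n}) is a length of a shortest tree graph connecting
  cubes □ building the domain X, and points x₁, …, x_n."*

WHAT THIS MODULE DOES (paper sub-cell `b2b-balaban-b11`, gen 8, node `STAR-DECAY-190` = kernel companion of cell
GAPS C-adv9-10; imports `Literature.Analysis.Complex.OsgoodProofs` (holomorphic ⇒ analytic on a finite-dimensional
domain, Cauchy estimates for the operator norms of `Dʲf`) and `…Balaban1983to89.B12Ineq45` (the consumer: (4.3) ⇒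
(4.5), `dirIter`, and the `n(p) = 1` input from the tree's (190)); modifies nothing; cell rows GAPS C-B11-G8a,
G-B11-G2a, G-IF-07, G-pv12-2 (a), C-adv9-10, DIVERGENCE D-B11-18):

Setting.  `E` = the space of B-configurations of [15] Sect. G (𝔤ᶜ-valued functions on the bonds of the finite set
𝔅_k — FINITE-DIMENSIONAL, `[FiniteDimensional ℂ E]`), `F` = the space of 𝐀-configurations (complete), `f = 𝓗`
holomorphic on an open `U ⊇ {‖B‖ < a}` (Prop. 9), `π : F →L[ℂ] G` a LOCALISATION of the output (the value, or
the block of values, of 𝓗(B) near an output block `b`; `G` complete, e.g. `ℂ`, `𝔤ᶜ`, or the functions on one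
block), and `iteratedFDeriv ℂ n f 0 m` = `⟨δⁿ𝓗(0), ⊗_{i<n} m_i⟩`, the object of B12 p. 282.

1. `norm_iteratedFDeriv_apply_le_of_ball` — Cauchy for the applied iterated derivative: `h : E → G` holomorphic on
   `U ⊇ ball 0 a`, `‖h‖ ≤ S` on the ball ⇒ `‖Dʲh(0)(w)‖ ≤ S (2j/a)ʲ Π_l ‖w_l‖` (the tree's operator-norm Cauchy
   inequalities `SCV.norm_iteratedFDeriv_le_of_closedBall` on `‖B‖ ≤ a/2` with `δ = a/(2j)`; the constant is the
   `(2r/α₂)^r` of `B12Ineq45.norm_dirIter_le_of_ball'`).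
2. `iteratedFDeriv_succ_apply_eq_last` — THE (185)-MOVE, `n`-th order: on the open set of holomorphy
   `D^{j+1}f(x)(m₀,…,m_j) = Dʲ(y ↦ δf(y)·m_j)(x)(m₀,…,m_{j−1})` — a higher variational derivative is an iterated
   derivative OF THE FIRST ONE `y ↦ ⟨δ𝓗(y), m_j⟩`, to which (190) applies at every (complex) `y` of the ball.
3. `norm_loc_iteratedFDeriv_succ_le_last` / `…_le_of_last` — KERNEL: if `‖π(δf(y)·m_j)‖ ≤ M` (resp. `≤ K β_j`)
   for all `y` in the ball ((190) at complex base points, localised at the output block) and `‖m_l‖ ≤ β_l`, then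
   `‖π(D^{j+1}f(0)(m))‖ ≤ M (2j/a)ʲ Π_{l<j} ‖m_l‖` (resp. `≤ K (2j/a)ʲ Π_{l≤j} β_l`): the weight carried by the
   LAST-inserted direction survives, the other directions cost only their sizes (Cauchy radii `a/(2j β_l)`).
4. `iteratedFDeriv_comp_perm_of_differentiableOn` — SYMMETRY of `δⁿ𝓗`: for `f` holomorphic on an open `U ∋ x` of a
   finite-dimensional `E`, `Dⁿf(x)(m ∘ σ) = Dⁿf(x)(m)` for every permutation `σ` (Osgood: holomorphic ⇒ analytic,
   tree `SCV.analyticAt_of_differentiableOn`; Mathlib `ContDiffAt.iteratedFDeriv_comp_perm`) — the *"Schwarz"* leaf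
   named in C-adv9-10 (iii); hence `norm_loc_iteratedFDeriv_succ_le_of_slot`: the weight of ANY ONE direction `m_i`
   survives (item 3 after the transposition `(i, last)`).
5. `norm_loc_iteratedFDeriv_succ_le_star` — STAR DECAY: if direction `i` carries the (190)-weight
   `K e^{−τ d_i}` (`d_i = d(b, x_i)`, the distance from the output block to the localisation of `B_i`), then
   `‖π(Dⁿf(0)(m))‖ ≤ K e^{−(τ/n) Σ_i d_i} (2(n−1)/a)^{n−1} Π_l β_l` (`n = j+1`; `min_i e^{−τd_i} = e^{−τ max_i d_i}`
   and `max ≥ mean`); `…_le_of_tree`: the same with any `T ≤ Σ_i d_i` in the exponent — the star from `b` through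
   `x₁, …, x_n` is a tree graph *"with n initial points and one final point"*, so the length of a SHORTEST such tree
   is at most `Σ_i d(b, x_i)`: the p. 282 / p. 286 *"exponential decay in a length of a shortest tree graph"* at
   the rate `τ/n` (cell SMALLNESS S-B12.17 family: B12's `δ₀` := `τ/n ≤ δ₀^{[15]}/(8n)`, `n ≤ 5` in §4).
6. `norm_loc_iteratedFDeriv_two_le_first_case` — THE p. 286 FIRST CASE (`n(p) = 2`, both points `x, x₃` in the
   same block): with `d(x, x₃) ≤ d(b, x) + d(b, x₃)` (triangle inequality through the output block),
   `‖π_b(D²f(0)(m_x, m_{x₃}))‖ ≤ K · e^{−(τ/4)d(x,x₃)} · e^{−(τ/4)(d(b,x)+d(b,x₃))} · (2/a) · β_x β_{x₃}` — the factor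
   `exp(−δ₀|x₃ − x|)` of p. 286 (with `δ₀^{[I]} := τ/4`) TOGETHER with both outside-localisation factors, the case
   that `B12Ineq45.term_bound_pair` (different blocks) explicitly leaves uncovered.
7. `dirIter_eq_iteratedFDeriv_rev` / `dirIter_eq_iteratedFDeriv` / `dirIter_comp_perm` — DICTIONARY to the
   consumer: on the set of holomorphy `B12Ineq45.dirIter r v f x = Dʳf(x)(v)` (any order of the directions), so the
   insertions `v_p` of (4.3) and the bounds `hv` of `B12Ineq45.term_bound(_pair)` for blocks with `n(p) ≥ 2` are
   supplied by items 3–6 (with `π` ranging over the output localisations entering the (4.4)-norm).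
8. `loc_fderiv_le_of_ineq190_localised` — CURRENCY BRIDGE for the hypothesis of items 3–6: at a complex base point
   `y` of the ball, the tree's (190) in the block-majorant vocabulary (`B11SectG.Ineq190` for an `ℝ`-linear model
   `dH` of `δ𝓗(y)`) + one row sum (`B12Ineq45.loc_dH_le_of_ineq190_localised`) give
   `‖π_b(δ𝓗(y)B)‖ ≤ (Cκ_Bc) e^{−τD} |B|` for `b ∈ X`, `B` vanishing within distance `D` of `X`, whenever the
   localisation `π_b` is dominated by the output block size at `b` — i.e. exactly the shape `K ω β` consumed above,
   with `K = B₃ = Cκ_Bc(σ)` and `τ = ⅛δ₀^{[15]} − σ` as in `B12Ineq45` item 6.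

WHAT IS *NOT* HERE: (190) itself and the analyticity of 𝓗 on `|B| < a` (Prop. 9 — hypotheses `hf`, `hball` and the
bounds `hM`/`hK`; cell GAPS G-B11-G2 (the omitted derivation of (189)) and G-B11-G2a (i) (the transport of (190) to
complex `V′`) stay the printed leaves); the infinite-dimensional version of item 4 (holomorphic ⇒ analytic for maps
of Banach spaces is neither in Mathlib nor in the tree — irrelevant for [15], whose configuration spaces on 𝔅_k are
finite-dimensional; cell DIVERGENCE D-B11-18); the identification of the (4.4)-norm with a supremum of output
localisations `π_b` and the summation over `b ∈ X` (one more row sum, cell GAPS G-pv12-2 (b)); the tree-graph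
EXPANSION of Sect. G for `δⁿ𝓗` (p. 282, first two sentences) — this module shows it is not needed for the USE made
of it on pp. 282/286: the shortest-tree decay at rate `τ/n` follows from the first-order (190) alone (C-adv9-10 (ii)).
Value = kernel certificate of a located by-derivation step (iterated Cauchy + symmetry) modulo the named printed
leaves, NOT summit progress.
-/

open Set Metric Filter Finset
open scoped Topology BigOperators ContDiff

namespace Literature.MathematicalPhysics.QuantumFieldTheory.Balaban1983to89.B11StarDecay190

open Literature.Analysis.Complex

/-! ## Cauchy for the applied iterated derivative, the (185)-move, symmetry -/

section Cauchy

variable {E : Type*} [NormedAddCommGroup E] [NormedSpace ℂ E] [FiniteDimensional ℂ E]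
  {F : Type*} [NormedAddCommGroup F] [NormedSpace ℂ F] [CompleteSpace F]
  {G : Type*} [NormedAddCommGroup G] [NormedSpace ℂ G] [CompleteSpace G]

/-- **Cauchy estimate for the applied iterated Fréchet derivative from a ball of holomorphy**: `h` holomorphic on
an open `U ⊇ ball 0 a`, `‖h‖ ≤ S` on `ball 0 a` ⇒ `‖Dʲh(0)(w₁,…,w_j)‖ ≤ S · (2j/a)ʲ · Π_l ‖w_l‖` (operator-norm
Cauchy inequalities on the closed ball of radius `a/2` with step `a/(2j)`, then `‖Dʲh(0)(w)‖ ≤ ‖Dʲh(0)‖ Π‖w_l‖`).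
[cite: HormanderSCV1973, Thm 2.2.7] -/
theorem norm_iteratedFDeriv_apply_le_of_ball {U : Set E} (hU : IsOpen U) {a S : ℝ} (ha : 0 < a)
    (hball : ball (0 : E) a ⊆ U) {h : E → G} (hh : DifferentiableOn ℂ h U)
    (hS : ∀ y ∈ ball (0 : E) a, ‖h y‖ ≤ S) (j : ℕ) (w : Fin j → E) :
    ‖iteratedFDeriv ℂ j h 0 w‖ ≤ S * (2 * j / a) ^ j * ∏ l, ‖w l‖ := by
  rcases Nat.eq_zero_or_pos j with rfl | hj
  · rw [iteratedFDeriv_zero_apply, pow_zero, mul_one, Fin.prod_univ_zero, mul_one]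
    exact hS 0 (mem_ball_self ha)
  have hjr : (0 : ℝ) < j := by exact_mod_cast hj
  have hj0 : (j : ℝ) ≠ 0 := hjr.ne'
  set δ : ℝ := a / (2 * j) with hδdef
  have hδ : 0 < δ := by positivity
  have hρU : closedBall (0 : E) (a / 2) ⊆ U :=
    (closedBall_subset_ball (by linarith)).trans hball
  have hM : ∀ z ∈ closedBall (0 : E) (a / 2), ‖h z‖ ≤ S :=
    fun z hz => hS z (closedBall_subset_ball (by linarith) hz)
  have hjδ : (j : ℝ) * δ = a / 2 := by
    rw [hδdef, mul_div_assoc', mul_comm (2 : ℝ) (j : ℝ), mul_div_mul_left a 2 hj0]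
  have hx' : (0 : E) ∈ closedBall (0 : E) (a / 2 - j * δ) := by
    rw [hjδ, sub_self]
    exact mem_closedBall_self le_rfl
  have hop := SCV.norm_iteratedFDeriv_le_of_closedBall hh hU hρU hM hδ j hjδ.le hx'
  have hSδ : S / δ ^ j = S * (2 * j / a) ^ j := by
    rw [div_eq_mul_inv, ← inv_pow, hδdef, inv_div]
  calc ‖iteratedFDeriv ℂ j h 0 w‖ ≤ ‖iteratedFDeriv ℂ j h 0‖ * ∏ l, ‖w l‖ :=
      (iteratedFDeriv ℂ j h 0).le_opNorm w
    _ ≤ S * (2 * j / a) ^ j * ∏ l, ‖w l‖ :=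
      mul_le_mul_of_nonneg_right (hop.trans hSδ.le) (Finset.prod_nonneg fun l _ => norm_nonneg _)

/-- **The (185)-move at order `n`** (B11 p. 308: *"(δ²/δA′² V)(A′)𝔄 = (d/dτ)(δ/δA′ V)(A′ + τ𝔄)|_{τ=0}"*): on the
open set of holomorphy, the `(j+1)`-st Fréchet derivative applied to `(m₀, …, m_j)` is the `j`-th derivative OF THE
FIRST VARIATIONAL DERIVATIVE in the last direction, `y ↦ δf(y)·m_j`, applied to `(m₀, …, m_{j−1})`.  (`f` is `C^∞`
on `U` by Osgood; Mathlib `iteratedFDeriv_succ_apply_right` + evaluation at `m_j` commutes with `Dʲ`.)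
[cite: Balaban1985Variational, (185) p.308] -/
theorem iteratedFDeriv_succ_apply_eq_last {U : Set E} (hU : IsOpen U) {f : E → F}
    (hf : DifferentiableOn ℂ f U) {x : E} (hx : x ∈ U) {j : ℕ} (m : Fin (j + 1) → E) :
    iteratedFDeriv ℂ (j + 1) f x m =
      iteratedFDeriv ℂ j (fun y => fderiv ℂ f y (m (Fin.last j))) x (Fin.init m) := by
  have hC : ContDiffOn ℂ ∞ f U := SCV.contDiffOn_infty hf hU
  have hf' : ContDiffOn ℂ ∞ (fderiv ℂ f) U := hC.fderiv_of_isOpen hU le_rfl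
  rw [iteratedFDeriv_succ_apply_right]
  have hcomp : (fun y => fderiv ℂ f y (m (Fin.last j))) =
      (ContinuousLinearMap.apply ℂ F (m (Fin.last j))) ∘ (fderiv ℂ f) := rfl
  rw [hcomp, (ContinuousLinearMap.apply ℂ F (m (Fin.last j))).iteratedFDeriv_comp_left
    ((hf' x hx).contDiffAt (hU.mem_nhds hx)) (mod_cast le_top)]
  simp only [ContinuousLinearMap.compContinuousMultilinearMap_coe, Function.comp_apply,
    ContinuousLinearMap.apply_apply]

/-- **Symmetry of `δⁿ𝓗`** (the *"Schwarz"* leaf of cell GAPS C-adv9-10 (iii)): a map holomorphic on an open subset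
of a finite-dimensional complex space is analytic there (Osgood, tree `SCV.analyticAt_of_differentiableOn`), so its
`n`-th Fréchet derivative is a SYMMETRIC multilinear form (Mathlib `ContDiffAt.iteratedFDeriv_comp_perm`).
[cite: HormanderSCV1973, Thm 2.2.1 and Thm 2.2.6] -/
theorem iteratedFDeriv_comp_perm_of_differentiableOn {U : Set E} (hU : IsOpen U) {f : E → F}
    (hf : DifferentiableOn ℂ f U) {x : E} (hx : x ∈ U) {n : ℕ} (m : Fin n → E) (σ : Equiv.Perm (Fin n)) :
    iteratedFDeriv ℂ n f x (m ∘ σ) = iteratedFDeriv ℂ n f x m :=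
  ((SCV.analyticAt_of_differentiableOn hf hU hx).contDiffAt (n := ω)).iteratedFDeriv_comp_perm m σ

/-! ## The kernel: one direction's (190)-weight survives, the others cost their sizes -/

/-- **Localised Cauchy bound keeping the weight of the LAST direction.**  `f = 𝓗` holomorphic on an open
`U ⊇ {‖B‖ < a}` (Prop. 9), `π` a localisation of the output, and the first-order input *at every complex base point
of the ball*: `‖π(δf(y)·m_j)‖ ≤ M` for `‖y‖ < a` ((190), localised).  Then
`‖π(D^{j+1}f(0)(m₀,…,m_j))‖ ≤ M · (2j/a)ʲ · Π_{l<j} ‖m_l‖` — item 2, then item 1 for the holomorphic map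
`π ∘ (y ↦ δf(y)·m_j)` (tree `SCV.differentiableOn_fderiv_apply`). [cite: Balaban1985Variational, (185)+(190) p.308;
Balaban1987RG1, p.282] -/
theorem norm_loc_iteratedFDeriv_succ_le_last {U : Set E} (hU : IsOpen U) {a : ℝ} (ha : 0 < a)
    (hball : ball (0 : E) a ⊆ U) {f : E → F} (hf : DifferentiableOn ℂ f U) (π : F →L[ℂ] G)
    {j : ℕ} (m : Fin (j + 1) → E) {M : ℝ}
    (hM : ∀ y ∈ ball (0 : E) a, ‖π (fderiv ℂ f y (m (Fin.last j)))‖ ≤ M) :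
    ‖π (iteratedFDeriv ℂ (j + 1) f 0 m)‖ ≤ M * (2 * j / a) ^ j * ∏ l : Fin j, ‖m (Fin.castSucc l)‖ := by
  set g : E → F := fun y => fderiv ℂ f y (m (Fin.last j)) with hgdef
  have h0 : (0 : E) ∈ U := hball (mem_ball_self ha)
  have hgU : DifferentiableOn ℂ g U := SCV.differentiableOn_fderiv_apply hf hU _
  have hπg : DifferentiableOn ℂ (π ∘ g) U := π.differentiable.comp_differentiableOn hgU
  have hgC : ContDiffAt ℂ ∞ g 0 := ((SCV.contDiffOn_infty hgU hU) 0 h0).contDiffAt (hU.mem_nhds h0)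
  have hcomm : iteratedFDeriv ℂ j (π ∘ g) 0 (Fin.init m) = π (iteratedFDeriv ℂ j g 0 (Fin.init m)) := by
    rw [π.iteratedFDeriv_comp_left hgC (mod_cast le_top)]
    rfl
  rw [iteratedFDeriv_succ_apply_eq_last hU hf h0 m, ← hgdef, ← hcomm]
  exact norm_iteratedFDeriv_apply_le_of_ball hU ha hball hπg (fun y hy => hM y hy) j (Fin.init m)

/-- The same with SIZES: `‖m_l‖ ≤ β_l` and the first-order input in the linear form of (190),
`‖π(δf(y)·m_j)‖ ≤ K β_j` on the ball ⇒ `‖π(D^{j+1}f(0)(m))‖ ≤ K · (2j/a)ʲ · Π_{l≤j} β_l` (the p. 282 shape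
`B₃ Π_i |B_i|` times the weight hidden in `K`). [cite: Balaban1987RG1, p.282; Balaban1985Variational, (190) p.308] -/
theorem norm_loc_iteratedFDeriv_succ_le_of_last {U : Set E} (hU : IsOpen U) {a : ℝ} (ha : 0 < a)
    (hball : ball (0 : E) a ⊆ U) {f : E → F} (hf : DifferentiableOn ℂ f U) (π : F →L[ℂ] G)
    {j : ℕ} (m : Fin (j + 1) → E) (β : Fin (j + 1) → ℝ) (hβ : ∀ l, ‖m l‖ ≤ β l) {K : ℝ}
    (hK : ∀ y ∈ ball (0 : E) a, ‖π (fderiv ℂ f y (m (Fin.last j)))‖ ≤ K * β (Fin.last j)) :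
    ‖π (iteratedFDeriv ℂ (j + 1) f 0 m)‖ ≤ K * (2 * j / a) ^ j * ∏ l, β l := by
  have h1 := norm_loc_iteratedFDeriv_succ_le_last hU ha hball hf π m hK
  have hKβ : 0 ≤ K * β (Fin.last j) := (norm_nonneg _).trans (hK 0 (mem_ball_self ha))
  have h2 : ∏ l : Fin j, ‖m (Fin.castSucc l)‖ ≤ ∏ l : Fin j, β (Fin.castSucc l) :=
    Finset.prod_le_prod (fun l _ => norm_nonneg _) fun l _ => hβ _
  calc ‖π (iteratedFDeriv ℂ (j + 1) f 0 m)‖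
        ≤ K * β (Fin.last j) * (2 * j / a) ^ j * ∏ l : Fin j, ‖m (Fin.castSucc l)‖ := h1
    _ ≤ K * β (Fin.last j) * (2 * j / a) ^ j * ∏ l : Fin j, β (Fin.castSucc l) :=
        mul_le_mul_of_nonneg_left h2 (mul_nonneg hKβ (pow_nonneg (by positivity) _))
    _ = K * (2 * j / a) ^ j * ∏ l, β l := by
        rw [Fin.prod_univ_castSucc]
        ring

/-- **The weight of ANY ONE direction survives** (symmetry, item 4, with the transposition `(i, last)`): if the
direction `m_i` carries the first-order input `‖π(δf(y)·m_i)‖ ≤ K β_i` on the ball, then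
`‖π(D^{j+1}f(0)(m))‖ ≤ K · (2j/a)ʲ · Π_l β_l`. This is the intra-block form of the p. 282 sentence *"if one of the
functions B_i is localized outside the domain X, then we have the additional exponential factor"*: the factor rides
in `K`, whichever slot `i` the localised function occupies. [cite: Balaban1987RG1, p.282; Balaban1985Variational,
(190) p.308] -/
theorem norm_loc_iteratedFDeriv_succ_le_of_slot {U : Set E} (hU : IsOpen U) {a : ℝ} (ha : 0 < a)
    (hball : ball (0 : E) a ⊆ U) {f : E → F} (hf : DifferentiableOn ℂ f U) (π : F →L[ℂ] G)
    {j : ℕ} (m : Fin (j + 1) → E) (i : Fin (j + 1)) (β : Fin (j + 1) → ℝ) (hβ : ∀ l, ‖m l‖ ≤ β l) {K : ℝ}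
    (hK : ∀ y ∈ ball (0 : E) a, ‖π (fderiv ℂ f y (m i))‖ ≤ K * β i) :
    ‖π (iteratedFDeriv ℂ (j + 1) f 0 m)‖ ≤ K * (2 * j / a) ^ j * ∏ l, β l := by
  set σ : Equiv.Perm (Fin (j + 1)) := Equiv.swap i (Fin.last j) with hσdef
  have h0 : (0 : E) ∈ U := hball (mem_ball_self ha)
  have hsymm : iteratedFDeriv ℂ (j + 1) f 0 m = iteratedFDeriv ℂ (j + 1) f 0 (m ∘ σ) :=
    (iteratedFDeriv_comp_perm_of_differentiableOn hU hf h0 m σ).symm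
  have hβ' : ∀ l, ‖(m ∘ σ) l‖ ≤ (β ∘ σ) l := fun l => hβ (σ l)
  have hK' : ∀ y ∈ ball (0 : E) a,
      ‖π (fderiv ℂ f y ((m ∘ σ) (Fin.last j)))‖ ≤ K * (β ∘ σ) (Fin.last j) := by
    intro y hy
    simpa [hσdef, Equiv.swap_apply_right] using hK y hy
  rw [hsymm]
  calc ‖π (iteratedFDeriv ℂ (j + 1) f 0 (m ∘ σ))‖ ≤ K * (2 * j / a) ^ j * ∏ l, (β ∘ σ) l :=
      norm_loc_iteratedFDeriv_succ_le_of_last hU ha hball hf π (m ∘ σ) (β ∘ σ) hβ' hK'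
    _ = K * (2 * j / a) ^ j * ∏ l, β l := by
      simp only [Function.comp_apply]
      rw [Equiv.prod_comp σ β]

/-! ## Star decay and the p. 286 first case -/

/-- **Star decay** (cell GAPS C-adv9-10 (ii)): with the (190)-weights `K e^{−τ d_i}` on every direction
(`d_i = d(b, x_i)`, output block `b`, `B_i` localised at `x_i`), `‖π(Dⁿf(0)(m))‖ ≤ K e^{−(τ/n) Σ_i d_i} ·
(2(n−1)/a)^{n−1} · Π_l β_l`, `n = j+1`: the best single slot gives `e^{−τ max_i d_i}`, and `max ≥ mean`.  The STAR
from `b` to `x₁, …, x_n` is a tree graph with `n` initial points and one final point, so this is decay *"in a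
length of a shortest tree graph"* (p. 282) at the rate `τ/n`. [cite: Balaban1987RG1, p.282 + p.286;
Balaban1985Variational, (190) p.308] -/
theorem norm_loc_iteratedFDeriv_succ_le_star {U : Set E} (hU : IsOpen U) {a : ℝ} (ha : 0 < a)
    (hball : ball (0 : E) a ⊆ U) {f : E → F} (hf : DifferentiableOn ℂ f U) (π : F →L[ℂ] G)
    {j : ℕ} (m : Fin (j + 1) → E) (β : Fin (j + 1) → ℝ) (hβ : ∀ l, ‖m l‖ ≤ β l) {K τ : ℝ} (hK : 0 ≤ K)
    (hτ : 0 ≤ τ) (d : Fin (j + 1) → ℝ)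
    (hKi : ∀ i, ∀ y ∈ ball (0 : E) a, ‖π (fderiv ℂ f y (m i))‖ ≤ K * Real.exp (-(τ * d i)) * β i) :
    ‖π (iteratedFDeriv ℂ (j + 1) f 0 m)‖ ≤
      K * Real.exp (-(τ / (j + 1) * ∑ i, d i)) * (2 * j / a) ^ j * ∏ l, β l := by
  obtain ⟨i₀, -, hi₀⟩ := Finset.exists_max_image Finset.univ d Finset.univ_nonempty
  have h1 := norm_loc_iteratedFDeriv_succ_le_of_slot hU ha hball hf π m i₀ β hβ (hKi i₀)
  have hsum : ∑ i, d i ≤ (j + 1) * d i₀ := by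
    calc ∑ i, d i ≤ ∑ _i : Fin (j + 1), d i₀ :=
          Finset.sum_le_sum fun i _ => hi₀ i (Finset.mem_univ _)
      _ = (j + 1) * d i₀ := by simp
  have hj : (0 : ℝ) < j + 1 := by positivity
  have hexp : Real.exp (-(τ * d i₀)) ≤ Real.exp (-(τ / (j + 1) * ∑ i, d i)) := by
    apply Real.exp_le_exp.mpr
    have h2 : τ / (j + 1) * ∑ i, d i ≤ τ / (j + 1) * ((j + 1) * d i₀) :=
      mul_le_mul_of_nonneg_left hsum (div_nonneg hτ hj.le)
    have h3 : τ / (j + 1) * ((j + 1) * d i₀) = τ * d i₀ := by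
      field_simp
    linarith
  have hβ0 : 0 ≤ ∏ l, β l := Finset.prod_nonneg fun l _ => (norm_nonneg _).trans (hβ l)
  calc ‖π (iteratedFDeriv ℂ (j + 1) f 0 m)‖
        ≤ K * Real.exp (-(τ * d i₀)) * (2 * j / a) ^ j * ∏ l, β l := h1
    _ ≤ K * Real.exp (-(τ / (j + 1) * ∑ i, d i)) * (2 * j / a) ^ j * ∏ l, β l :=
        mul_le_mul_of_nonneg_right
          (mul_le_mul_of_nonneg_right (mul_le_mul_of_nonneg_left hexp hK)
            (pow_nonneg (by positivity) _)) hβ0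

/-- **Shortest tree.**  Any quantity `T ≤ Σ_i d(b, x_i)` — in particular the length of a shortest tree graph on
`{b, x₁, …, x_n}` (B12 p. 286 *"d_j(X∪{x₁, …, x_n}) is a length of a shortest tree graph connecting cubes □ building
the domain X, and points x₁, …, x_n"*, here with the one output block `b`), which the star from `b` dominates —
inherits the bound: `‖π(Dⁿf(0)(m))‖ ≤ K e^{−(τ/n) T} (2(n−1)/a)^{n−1} Π_l β_l`. [cite: Balaban1987RG1, p.286] -/
theorem norm_loc_iteratedFDeriv_succ_le_of_tree {U : Set E} (hU : IsOpen U) {a : ℝ} (ha : 0 < a)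
    (hball : ball (0 : E) a ⊆ U) {f : E → F} (hf : DifferentiableOn ℂ f U) (π : F →L[ℂ] G)
    {j : ℕ} (m : Fin (j + 1) → E) (β : Fin (j + 1) → ℝ) (hβ : ∀ l, ‖m l‖ ≤ β l) {K τ : ℝ} (hK : 0 ≤ K)
    (hτ : 0 ≤ τ) (d : Fin (j + 1) → ℝ)
    (hKi : ∀ i, ∀ y ∈ ball (0 : E) a, ‖π (fderiv ℂ f y (m i))‖ ≤ K * Real.exp (-(τ * d i)) * β i)
    {T : ℝ} (hT : T ≤ ∑ i, d i) :
    ‖π (iteratedFDeriv ℂ (j + 1) f 0 m)‖ ≤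
      K * Real.exp (-(τ / (j + 1) * T)) * (2 * j / a) ^ j * ∏ l, β l := by
  have h1 := norm_loc_iteratedFDeriv_succ_le_star hU ha hball hf π m β hβ hK hτ d hKi
  have hj : (0 : ℝ) < j + 1 := by positivity
  have hexp : Real.exp (-(τ / (j + 1) * ∑ i, d i)) ≤ Real.exp (-(τ / (j + 1) * T)) :=
    Real.exp_le_exp.mpr (by nlinarith [div_nonneg hτ hj.le])
  have hβ0 : 0 ≤ ∏ l, β l := Finset.prod_nonneg fun l _ => (norm_nonneg _).trans (hβ l)
  exact h1.trans (mul_le_mul_of_nonneg_right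
    (mul_le_mul_of_nonneg_right (mul_le_mul_of_nonneg_left hexp hK) (pow_nonneg (by positivity) _)) hβ0)

/-- **B12 p. 286, FIRST CASE** (*"the points x, x₃ are connected with the same set N(p) in (4.3). Then the
exponential factor, with a length of a shortest tree graph in the exponent, yields the factor exp(−δ₀|x₃ − x|)"*),
derived: `f = 𝓗` holomorphic on `U ⊇ {‖B‖ < a}`, the two directions `m₀ = δB` at `x` and `m₁` at `x₃` with the
localised (190)-inputs `‖π_b(δf(y)·m₀)‖ ≤ K e^{−τ d(b,x)} β₀`, `‖π_b(δf(y)·m₁)‖ ≤ K e^{−τ d(b,x₃)} β₁` on the ball,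
and the triangle inequality `d(x, x₃) ≤ d(b, x) + d(b, x₃)` through the output block ⇒
`‖π_b(D²f(0)(m₀, m₁))‖ ≤ K · e^{−(τ/4) d(x,x₃)} · e^{−(τ/4)(d(b,x) + d(b,x₃))} · (2/a) · β₀ β₁` — the printed factor
with `δ₀^{[I]} := τ/4` AND both outside-localisation factors at once (the case not covered by
`B12Ineq45.term_bound_pair`). [cite: Balaban1987RG1, p.286; Balaban1985Variational, (185)+(190) p.308] -/
theorem norm_loc_iteratedFDeriv_two_le_first_case {U : Set E} (hU : IsOpen U) {a : ℝ} (ha : 0 < a)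
    (hball : ball (0 : E) a ⊆ U) {f : E → F} (hf : DifferentiableOn ℂ f U) (π : F →L[ℂ] G)
    (m : Fin 2 → E) (β : Fin 2 → ℝ) (hβ : ∀ l, ‖m l‖ ≤ β l) {K τ : ℝ} (hK : 0 ≤ K) (hτ : 0 ≤ τ)
    {dbx dbx₃ dxx₃ : ℝ} (htri : dxx₃ ≤ dbx + dbx₃)
    (h₀ : ∀ y ∈ ball (0 : E) a, ‖π (fderiv ℂ f y (m 0))‖ ≤ K * Real.exp (-(τ * dbx)) * β 0)
    (h₁ : ∀ y ∈ ball (0 : E) a, ‖π (fderiv ℂ f y (m 1))‖ ≤ K * Real.exp (-(τ * dbx₃)) * β 1) :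
    ‖π (iteratedFDeriv ℂ 2 f 0 m)‖ ≤
      K * (Real.exp (-(τ / 4 * dxx₃)) * Real.exp (-(τ / 4 * (dbx + dbx₃)))) * (2 / a) * (β 0 * β 1) := by
  -- the better of the two slots carries `e^{−τ max(d(b,x), d(b,x₃))}`
  have hβ0 : 0 ≤ β 0 * β 1 :=
    mul_nonneg ((norm_nonneg _).trans (hβ 0)) ((norm_nonneg _).trans (hβ 1))
  have key : ∀ D : ℝ, dbx + dbx₃ ≤ 2 * D →
      (∃ i : Fin 2, ∀ y ∈ ball (0 : E) a, ‖π (fderiv ℂ f y (m i))‖ ≤ K * Real.exp (-(τ * D)) * β i) →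
      ‖π (iteratedFDeriv ℂ 2 f 0 m)‖ ≤
        K * (Real.exp (-(τ / 4 * dxx₃)) * Real.exp (-(τ / 4 * (dbx + dbx₃)))) * (2 / a) * (β 0 * β 1) := by
    intro D hD ⟨i, hi⟩
    have h1 := norm_loc_iteratedFDeriv_succ_le_of_slot hU ha hball hf π m i β hβ hi
    have hexp : Real.exp (-(τ * D)) ≤
        Real.exp (-(τ / 4 * dxx₃)) * Real.exp (-(τ / 4 * (dbx + dbx₃))) := by
      rw [← Real.exp_add]
      exact Real.exp_le_exp.mpr (by nlinarith)
    calc ‖π (iteratedFDeriv ℂ 2 f 0 m)‖ ≤ K * Real.exp (-(τ * D)) * (2 * (1 : ℕ) / a) ^ 1 * ∏ l, β l := h1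
      _ = K * Real.exp (-(τ * D)) * (2 / a) * (β 0 * β 1) := by
          rw [Fin.prod_univ_two, Nat.cast_one, mul_one, pow_one]
      _ ≤ K * (Real.exp (-(τ / 4 * dxx₃)) * Real.exp (-(τ / 4 * (dbx + dbx₃)))) * (2 / a) * (β 0 * β 1) :=
          mul_le_mul_of_nonneg_right
            (mul_le_mul_of_nonneg_right (mul_le_mul_of_nonneg_left hexp hK) (by positivity)) hβ0
  rcases le_total dbx dbx₃ with hle | hle
  · exact key dbx₃ (by linarith) ⟨1, h₁⟩
  · exact key dbx (by linarith) ⟨0, h₀⟩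

/-! ## Dictionary to the consumer `B12Ineq45` -/

/-- On the open set of holomorphy, `B12Ineq45.dirIter r v f x` (differentiate along `v 0` first) is the `r`-th
Fréchet derivative applied to the directions in REVERSE order: `Dʳf(x)(v_{r−1}, …, v₀)`. [folklore] -/
theorem dirIter_eq_iteratedFDeriv_rev {U : Set E} (hU : IsOpen U) :
    ∀ (r : ℕ) {f : E → F}, DifferentiableOn ℂ f U → ∀ (v : Fin r → E) {x : E}, x ∈ U →
      B12Ineq45.dirIter r v f x = iteratedFDeriv ℂ r f x (v ∘ Fin.rev) := by
  intro r
  induction r with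
  | zero =>
    intro f _ v x _
    rw [B12Ineq45.dirIter_zero, iteratedFDeriv_zero_apply]
  | succ r ih =>
    intro f hf v x hx
    rw [B12Ineq45.dirIter_succ, iteratedFDeriv_succ_apply_eq_last hU hf hx]
    have hlast : (v ∘ Fin.rev) (Fin.last r) = v 0 := by
      simp [Fin.rev_last]
    have hinit : Fin.init (v ∘ Fin.rev) = Fin.tail v ∘ Fin.rev := by
      funext l
      simp [Fin.init, Fin.tail, Fin.rev_castSucc]
    rw [hlast, hinit]
    exact ih (SCV.differentiableOn_fderiv_apply hf hU (v 0)) (Fin.tail v) hx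

/-- Hence, by the symmetry of item 4, `dirIter r v f x = Dʳf(x)(v₀, …, v_{r−1})`: the insertions
`⟨δʳ𝐄, ⊗_p v_p⟩` of (4.3) are values of the symmetric multilinear form `Dʳf(x)`. [folklore] -/
theorem dirIter_eq_iteratedFDeriv {U : Set E} (hU : IsOpen U) {r : ℕ} {f : E → F}
    (hf : DifferentiableOn ℂ f U) (v : Fin r → E) {x : E} (hx : x ∈ U) :
    B12Ineq45.dirIter r v f x = iteratedFDeriv ℂ r f x v := by
  rw [dirIter_eq_iteratedFDeriv_rev hU r hf v hx]
  exact iteratedFDeriv_comp_perm_of_differentiableOn hU hf hx v Fin.revPerm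

/-- `dirIter` does not depend on the order of the directions (on the set of holomorphy). [folklore] -/
theorem dirIter_comp_perm {U : Set E} (hU : IsOpen U) {r : ℕ} {f : E → F}
    (hf : DifferentiableOn ℂ f U) (v : Fin r → E) (σ : Equiv.Perm (Fin r)) {x : E} (hx : x ∈ U) :
    B12Ineq45.dirIter r (v ∘ σ) f x = B12Ineq45.dirIter r v f x := by
  rw [dirIter_eq_iteratedFDeriv hU hf _ hx, dirIter_eq_iteratedFDeriv hU hf _ hx]
  exact iteratedFDeriv_comp_perm_of_differentiableOn hU hf hx v σ

/-- **The consumer's hypothesis `hv`, supplied for blocks with `n(p) ≥ 2`.**  In the currency of `B12Ineq45`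
(the insertions `v_p = dirIter n(p) (B_i)_{i∈N(p)} 𝐇 0` of (4.3)): if one direction `m_i` carries the localised
first-order input `‖π(δf(y)·m_i)‖ ≤ K β_i` on the ball and `‖m_l‖ ≤ β_l`, then
`‖π(dirIter (j+1) m f 0)‖ ≤ K · (2j/a)ʲ · Π_l β_l` (item 7 + `norm_loc_iteratedFDeriv_succ_le_of_slot`).
[cite: Balaban1987RG1, (4.3) p.281 + p.282] -/
theorem norm_loc_dirIter_succ_le_of_slot {U : Set E} (hU : IsOpen U) {a : ℝ} (ha : 0 < a)
    (hball : ball (0 : E) a ⊆ U) {f : E → F} (hf : DifferentiableOn ℂ f U) (π : F →L[ℂ] G)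
    {j : ℕ} (m : Fin (j + 1) → E) (i : Fin (j + 1)) (β : Fin (j + 1) → ℝ) (hβ : ∀ l, ‖m l‖ ≤ β l) {K : ℝ}
    (hK : ∀ y ∈ ball (0 : E) a, ‖π (fderiv ℂ f y (m i))‖ ≤ K * β i) :
    ‖π (B12Ineq45.dirIter (j + 1) m f 0)‖ ≤ K * (2 * j / a) ^ j * ∏ l, β l := by
  rw [dirIter_eq_iteratedFDeriv hU hf m (hball (mem_ball_self ha))]
  exact norm_loc_iteratedFDeriv_succ_le_of_slot hU ha hball hf π m i β hβ hK

end Cauchy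

/-! ## Currency bridge: the hypothesis `hK` from the tree's (190) at a complex base point -/

section FromB11

open B11SectG

variable {g : B6.Geometry} {E F : Type} [NormedAddCommGroup E] [NormedSpace ℂ E]
  [NormedAddCommGroup F] [NormedSpace ℂ F]
  {G : Type*} [NormedAddCommGroup G] [NormedSpace ℂ G]

/-- **(190) at a complex base point ⇒ the first-order input of the star-decay theorems.**  Let `T = δ𝓗(y)` (the
Fréchet derivative of 𝓗 at a point `y` of the COMPLEX ball of Prop. 9 — (190) is asserted there for every such `B`,
`B11.Prop9Printed`), modelled as an `ℝ`-linear map `dH` between the block-normed spaces of `B11SectG` satisfying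
`Ineq190 bB bout dH C δ₀`; let the output localisation `π_b` be dominated by the output block size at `b ∈ X`, and
let `B` (all block sizes `≤ |B|`) vanish on the blocks closer than `D` to `X`.  Then, by
`B12Ineq45.loc_dH_le_of_ineq190_localised` (one row sum at rate `σ`, `σ + τ ≤ ⅛δ₀`),
`‖π_b(δ𝓗(y)B)‖ ≤ (Cκ_Bc) · e^{−τD} · |B|` — the shape `K · ω · β` of `hK`/`hKi` above with `K = B₃ = Cκ_Bc(σ)`.
[cite: Balaban1985Variational, Prop. 9 (190) pp.308–309; Balaban1987RG1, p.282; Balaban1984PropagatorsII,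
Lemma 2.1 (2.61) p.234] -/
theorem loc_fderiv_le_of_ineq190_localised {bB : BlockNorm g E} {bout : BlockNorm g F} {T : E → F}
    {dH : E →ₗ[ℝ] F} (hdH : ∀ B, dH B = T B) {C δ₀ σ τ c mB D : ℝ} (h190 : Ineq190 bB bout dH C δ₀)
    (hC : 0 ≤ C) (hd : ∀ a b : g.Site, 0 ≤ g.dist a b) (hrow : RowSum g σ c) (hτ : 0 ≤ τ)
    (hστ : σ + τ ≤ δ₀ / 8) (B : E) (hm : ∀ y', bB.loc y' B ≤ mB) (X : Set g.Site)
    (hD : ∀ y ∈ X, ∀ y', bB.loc y' B ≠ 0 → D ≤ g.dist y y') {b : g.Site} (hb : b ∈ X)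
    (π : F →L[ℂ] G) (hπ : ∀ v, ‖π v‖ ≤ bout.loc b v) :
    ‖π (T B)‖ ≤ C * bB.κ * c * Real.exp (-(τ * D)) * mB := by
  have h := B12Ineq45.loc_dH_le_of_ineq190_localised h190 hC hd hrow hτ hστ B hm X hD hb
  rw [hdH] at h
  calc ‖π (T B)‖ ≤ bout.loc b (T B) := hπ _
    _ ≤ C * bB.κ * c * mB * Real.exp (-(τ * D)) := h
    _ = C * bB.κ * c * Real.exp (-(τ * D)) * mB := by ring

end FromB11

end Literature.MathematicalPhysics.QuantumFieldTheory.Balaban1983to89.B11StarDecay190
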